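import Mathlib
import Literature.NumberTheory.EllipticCurves.GaloisAction
import HarnessLib

/-!
# CM torsion core, helpers 6/8: the equivariant section (Maschke by averaging)

Helper file (6/8) for stub `stub_CMTorsionCoreOf` ((K†), the CM torsion core) of line
`Sketch` (isotypic–Minkowski reduction) of crux U
`Summit.ABC.ABC.Theses.IsogenyGlueCongruence.EllipticGluingPrimeBound` (stmt-ABC-13919); the stub
itself is proved in `…EllipticGluingPrimeBoundStubCMTorsionCoreOf`.

* `exists_equivariant_injective` (registered sub-goal) — from step 0 of the big-image core (an
  `ℓ`-torsion subgroup `S ≤ P^r` stable under the twisted operators `c(σ) ⊗ σ`, with an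
  equivariant surjection `π' : S ↠ V = P[ℓ]`), an injective additive `j : V → V^r` equivariant
  for a subgroup `Γ₀` whose image on `V^r × V` is shown to be finite of order prime to `ℓ`: `j` is
  the average of a linear section of `π'` over that image (Maschke's argument, with no
  semisimplicity statement).

Pure algebra; everything is proved; no `def`, no named fact.
-/

noncomputable section

-- `Summit.<Summit>.<Problem>` is the mandated summit-side namespace (CONVENTIONS §2); for the
-- single-conjunct summit `ABC` the two coincide, so the duplicate `ABC.ABC` is deliberate.
set_option linter.dupNamespace false

namespace Summit.ABC.ABC.Theorems.IsotypicMinkowski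

open scoped AddSubgroup Matrix

/-! ## The equivariant section (registered sub-goal of the stub) -/


/-- **The equivariant section (Maschke by averaging).** From step 0 of the big-image core — an
`ℓ`-torsion subgroup `S ≤ P^r` stable under the twisted operators `c(σ) ⊗ σ` with an equivariant
surjection `π' : S ↠ V = P[ℓ]` — an INJECTIVE additive `j : V → V^r`, equivariant for a subgroup
`Γ₀`: the image `Q` of `Γ₀` in `Aut(V^r) × Aut(V)` is finite of order prime to `ℓ` (an element of
order `ℓ` would come from `σ` with `σ^ℓ` trivial on `V`, hence `σ` trivial on `V` by `h1`, and then
`σ^m ↦ 1` with `ℓ ∤ m` by `h2`), and `j = ∑_{q ∈ Q} q₁ ∘ s₀ ∘ q₂⁻¹` for a linear section `s₀` of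
`π'`
has `π' ∘ j = |Q|`. [folklore] -/
theorem exists_equivariant_injective {Γ P H : Type} [Group Γ] [AddCommGroup P]
    [AddCommGroup H] [DistribMulAction Γ P] {ℓ : ℕ} [Fact ℓ.Prime]
    [Module (ZMod ℓ) (AddSubgroup.torsionBy P ℓ)] [Finite (AddSubgroup.torsionBy P ℓ)]
    [Nontrivial (AddSubgroup.torsionBy P ℓ)]
    (ρ : Representation ℤ Γ H) {r : ℕ} (b : Module.Basis (Fin r) ℤ H) (Γ₀ : Subgroup Γ)
    (h1 : ∀ σ ∈ Γ₀, (∀ v : AddSubgroup.torsionBy P ℓ, σ ^ ℓ • v = v) →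
      ∀ v : AddSubgroup.torsionBy P ℓ, σ • v = v)
    (h2 : ∃ m : ℕ, ¬ ℓ ∣ m ∧ ∀ σ : Γ, LinearMap.toMatrix b b (ρ σ) ^ m = 1)
    (S : AddSubgroup (Fin r → P))
    (hS : ∀ σ : Γ, ∀ R ∈ S, (fun k ↦ ∑ i, LinearMap.toMatrix b b (ρ σ) k i • σ • R i) ∈ S)
    (π' : S →+ AddSubgroup.torsionBy P ℓ) (hSℓ : ∀ R ∈ S, ℓ • R = 0)
    (hπ's : Function.Surjective π')
    (hπ't : ∀ (σ : Γ) (R : S), π' ⟨_, hS σ R R.2⟩ = σ • π' R) :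
    ∃ j : AddSubgroup.torsionBy P ℓ →+ (Fin r → AddSubgroup.torsionBy P ℓ),
      Function.Injective j ∧ ∀ σ ∈ Γ₀, ∀ v,
        j (σ • v) = fun k ↦ ∑ i, LinearMap.toMatrix b b (ρ σ) k i • σ • j v i := by
  classical
  have hprime : ℓ.Prime := Fact.out
  -- notation: `V = P[ℓ]`, `M = V^r`, the matrices `c σ`
  set c : Γ → Matrix (Fin r) (Fin r) ℤ := fun σ ↦ LinearMap.toMatrix b b (ρ σ) with hc
  have hcmul : ∀ σ τ, c (σ * τ) = c σ * c τ := fun σ τ ↦ by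
    simp only [hc, map_mul, LinearMap.toMatrix_mul]
  have hcone : c 1 = 1 := by simp only [hc, map_one, LinearMap.toMatrix_one]
  have hσz : ∀ (σ : Γ) (n : ℤ) (v : AddSubgroup.torsionBy P ℓ), σ • n • v = n • σ • v :=
    fun σ n v ↦ map_zsmul (DistribSMul.toAddMonoidHom (AddSubgroup.torsionBy P ℓ) σ) n v
  -- the twisted operators on `M = V^r`
  let sF : Γ → (Fin r → AddSubgroup.torsionBy P ℓ) →+ (Fin r → AddSubgroup.torsionBy P ℓ) :=
    fun σ ↦ AddMonoidHom.pi fun k ↦ ∑ i, c σ k i •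
      ((DistribSMul.toAddMonoidHom (AddSubgroup.torsionBy P ℓ) σ).comp
        (Pi.evalAddMonoidHom (fun _ ↦ AddSubgroup.torsionBy P ℓ) i))
  have hsF : ∀ σ R, sF σ R = fun k ↦ ∑ i, c σ k i • σ • R i := fun σ R ↦ by
    ext k
    simp only [sF, AddMonoidHom.pi_apply, AddMonoidHom.finsetSum_apply, AddMonoidHom.smul_apply,
      AddMonoidHom.coe_comp, Function.comp_apply, Pi.evalAddMonoidHom_apply,
      DistribSMul.toAddMonoidHom_apply]
  have hsF_one : sF 1 = AddMonoidHom.id _ := AddMonoidHom.ext fun R ↦ by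
    rw [hsF, AddMonoidHom.id_apply]
    funext k
    simp only [one_smul, hcone, Matrix.one_apply, ite_smul, zero_smul, Finset.sum_ite_eq,
      Finset.mem_univ, if_true]
  have hsF_mul : ∀ σ τ, sF (σ * τ) = (sF σ).comp (sF τ) := fun σ τ ↦ AddMonoidHom.ext fun R ↦ by
    rw [AddMonoidHom.comp_apply, hsF, hsF, hsF]
    funext k
    simp only [hcmul, Matrix.mul_apply, Finset.sum_smul, mul_smul, Finset.smul_sum, hσz]
    rw [Finset.sum_comm]
  -- as a monoid homomorphism
  let sM : Γ →* AddMonoid.End (Fin r → AddSubgroup.torsionBy P ℓ) :=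
    { toFun := sF, map_one' := hsF_one, map_mul' := hsF_mul }
  have hsM : ∀ σ, sM σ = sF σ := fun _ ↦ rfl
  -- coordinates `M = V^r → P^r`
  let incl : (Fin r → AddSubgroup.torsionBy P ℓ) →+ (Fin r → P) :=
    AddMonoidHom.pi fun i ↦ (AddSubgroup.torsionBy P ℓ).subtype.comp (Pi.evalAddMonoidHom _ i)
  have hincl : ∀ R i, incl R i = (R i : P) := fun R i ↦ rfl
  have hincl_sF : ∀ σ R, incl (sF σ R) = fun k ↦ ∑ i, c σ k i • σ • incl R i := fun σ R ↦ by
    funext k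
    rw [hincl, hsF, AddSubgroup.val_finsetSum]
    refine Finset.sum_congr rfl fun i _ ↦ ?_
    rw [AddSubgroupClass.coe_zsmul, hincl]
    rfl
  -- the stable submodule `SM = S ∩ M` and `πM : SM ↠ V`
  let SM : Submodule (ZMod ℓ) (Fin r → AddSubgroup.torsionBy P ℓ) :=
    AddSubgroup.toZModSubmodule ℓ (S.comap incl)
  have hSM : ∀ R, R ∈ SM ↔ incl R ∈ S := fun R ↦ by
    rw [AddSubgroup.mem_toZModSubmodule, AddSubgroup.mem_comap]
  have hSMst : ∀ σ, ∀ R ∈ SM, sF σ R ∈ SM := fun σ R hR ↦ by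
    rw [hSM] at hR ⊢
    rw [hincl_sF]
    exact hS σ _ hR
  let toS : SM →+ S := (incl.comp SM.subtype.toAddMonoidHom).codRestrict S (fun R ↦ (hSM R.1).1 R.2)
  have htoS : ∀ R : SM, (toS R : Fin r → P) = incl R := fun R ↦ rfl
  let πM : SM →+ AddSubgroup.torsionBy P ℓ := π'.comp toS
  have hπM : ∀ R : SM, πM R = π' (toS R) := fun R ↦ rfl
  have hlift : ∀ R : S, ∃ R' : SM, toS R' = R := fun R ↦ by
    have hRℓ : ∀ i, (R : Fin r → P) i ∈ AddSubgroup.torsionBy P ℓ := fun i ↦ by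
      rw [AddSubgroup.torsionBy.nsmul_iff, ← Pi.smul_apply, hSℓ _ R.2, Pi.zero_apply]
    have hR' : (incl fun i ↦ ⟨(R : Fin r → P) i, hRℓ i⟩) = R := funext fun i ↦ rfl
    exact ⟨⟨fun i ↦ ⟨(R : Fin r → P) i, hRℓ i⟩, (hSM _).2 (by rw [hR']; exact R.2)⟩,
      Subtype.ext hR'⟩
  have hπMsurj : Function.Surjective πM := fun v ↦ by
    obtain ⟨R, hR⟩ := hπ's v
    obtain ⟨R', hR'⟩ := hlift R
    exact ⟨R', by rw [hπM, hR', hR]⟩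
  have hπMt : ∀ (σ : Γ) (R : SM), πM ⟨sF σ R, hSMst σ R R.2⟩ = σ • πM R := fun σ R ↦ by
    rw [hπM, hπM, ← hπ't σ (toS R)]
    congr 1
    apply Subtype.ext
    rw [htoS, hincl_sF]
    rfl
  -- the finite image `Q` of `Γ₀` acting on `M` and on `V`
  let Θ₁ : Γ →* (AddMonoid.End (Fin r → AddSubgroup.torsionBy P ℓ))ˣ := sM.toHomUnits
  let Θ₂ : Γ →* (AddMonoid.End (AddSubgroup.torsionBy P ℓ))ˣ :=
    (DistribMulAction.toAddMonoidEnd Γ (AddSubgroup.torsionBy P ℓ)).toHomUnits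
  let Θ : Γ₀ →* (AddMonoid.End (Fin r → AddSubgroup.torsionBy P ℓ))ˣ ×
      (AddMonoid.End (AddSubgroup.torsionBy P ℓ))ˣ := (Θ₁.prod Θ₂).comp Γ₀.subtype
  have hΘ₁ : ∀ σ : Γ₀, (((Θ σ).1 : (AddMonoid.End (Fin r → AddSubgroup.torsionBy P ℓ))ˣ) :
      AddMonoid.End (Fin r → AddSubgroup.torsionBy P ℓ)) = sF σ := fun _ ↦ rfl
  have hΘ₂ : ∀ (σ : Γ₀) (v : AddSubgroup.torsionBy P ℓ),
      (((Θ σ).2 : (AddMonoid.End (AddSubgroup.torsionBy P ℓ))ˣ) :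
        AddMonoid.End (AddSubgroup.torsionBy P ℓ)) v = (σ : Γ) • v := fun _ _ ↦ rfl
  have hΘ₂' : ∀ (σ : Γ₀) (v : AddSubgroup.torsionBy P ℓ),
      (((Θ σ).2⁻¹ : (AddMonoid.End (AddSubgroup.torsionBy P ℓ))ˣ) :
        AddMonoid.End (AddSubgroup.torsionBy P ℓ)) v = (σ : Γ)⁻¹ • v := fun σ v ↦ by
    have h : (Θ σ).2⁻¹ = (Θ σ⁻¹).2 := by rw [map_inv, Prod.snd_inv]
    rw [h, hΘ₂, Subgroup.coe_inv]
  let Q : Subgroup ((AddMonoid.End (Fin r → AddSubgroup.torsionBy P ℓ))ˣ ×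
      (AddMonoid.End (AddSubgroup.torsionBy P ℓ))ˣ) := Θ.range
  haveI : Finite (AddMonoid.End (Fin r → AddSubgroup.torsionBy P ℓ)) :=
    Finite.of_injective (fun f : (Fin r → AddSubgroup.torsionBy P ℓ) →+ (Fin r →
        AddSubgroup.torsionBy P ℓ)
      ↦ (f : (Fin r → AddSubgroup.torsionBy P ℓ) → (Fin r → AddSubgroup.torsionBy P ℓ)))
      DFunLike.coe_injective
  haveI : Finite (AddMonoid.End (AddSubgroup.torsionBy P ℓ)) :=
    Finite.of_injective (fun f : AddSubgroup.torsionBy P ℓ →+ AddSubgroup.torsionBy P ℓ ↦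
      (f : AddSubgroup.torsionBy P ℓ → AddSubgroup.torsionBy P ℓ)) DFunLike.coe_injective
  haveI : Fintype Q := Fintype.ofFinite Q
  -- `ℓ ∤ |Q|`: an element of order `ℓ` would come from `σ` with `σ ^ m ↦ 1`, `ℓ ∤ m`
  obtain ⟨m, hℓm, hm⟩ := h2
  have hcpow : ∀ (τ : Γ) (n : ℕ), c (τ ^ n) = c τ ^ n := fun τ n ↦ by
    induction n with
    | zero => rw [pow_zero, pow_zero, hcone]
    | succ n ih => rw [pow_succ, pow_succ, hcmul, ih]
  have hQℓ : ¬ ℓ ∣ Fintype.card Q := by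
    intro hdiv
    obtain ⟨q, hq⟩ := exists_prime_orderOf_dvd_card ℓ hdiv
    obtain ⟨σ, hσq⟩ := q.2
    have hqℓ : (q ^ ℓ).val = 1 := by
      have h := pow_orderOf_eq_one q
      rw [hq] at h
      rw [h]
      rfl
    have hσℓ : Θ (σ ^ ℓ) = 1 := by rw [map_pow, hσq, ← Subgroup.coe_pow, hqℓ]
    have hVℓ : ∀ v : AddSubgroup.torsionBy P ℓ, (σ : Γ) ^ ℓ • v = v := fun v ↦ by
      have h := congrArg (fun x : ((AddMonoid.End (Fin r → AddSubgroup.torsionBy P ℓ))ˣ ×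
          (AddMonoid.End (AddSubgroup.torsionBy P ℓ))ˣ) ↦
        (x.2 : AddMonoid.End (AddSubgroup.torsionBy P ℓ)) v) hσℓ
      simp only [hΘ₂, Subgroup.coe_pow] at h
      exact h
    have hσV : ∀ v : AddSubgroup.torsionBy P ℓ, (σ : Γ) • v = v := h1 σ σ.2 hVℓ
    have hσVn : ∀ (n : ℕ) (v : AddSubgroup.torsionBy P ℓ), (σ : Γ) ^ n • v = v := fun n ↦ by
      induction n with
      | zero => intro v; rw [pow_zero, one_smul]
      | succ n ih => intro v; rw [pow_succ, mul_smul, hσV, ih]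
    have hm' : ∀ τ : Γ, c τ ^ m = 1 := fun τ ↦ hm τ
    have hσm : Θ (σ ^ m) = 1 := by
      refine Prod.ext (Units.ext ?_) (Units.ext ?_)
      · rw [hΘ₁]
        change sF ((σ : Γ) ^ m) = AddMonoidHom.id _
        refine AddMonoidHom.ext fun R ↦ ?_
        rw [hsF, AddMonoidHom.id_apply]
        funext k
        simp only [hσVn, hcpow, hm', Matrix.one_apply, ite_smul, one_smul, zero_smul,
          Finset.sum_ite_eq, Finset.mem_univ, if_true]
      · refine AddMonoidHom.ext fun v ↦ ?_
        change ((σ ^ m : Γ₀) : Γ) • v = v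
        rw [Subgroup.coe_pow, hσVn]
    have hqm : q ^ m = 1 := Subtype.ext (by rw [Subgroup.coe_pow, ← hσq, ← map_pow, hσm]; rfl)
    have hdvd : orderOf q ∣ m := orderOf_dvd_of_pow_eq_one hqm
    rw [hq] at hdvd
    exact hℓm hdvd
  -- a linear section `s₀` of `πM`
  haveI : Module.Finite (ZMod ℓ) (AddSubgroup.torsionBy P ℓ) := Module.Finite.of_finite
  let bV := Module.finBasis (ZMod ℓ) (AddSubgroup.torsionBy P ℓ)
  have hsec : ∀ i, ∃ x : SM, πM x = bV i := fun i ↦ hπMsurj (bV i)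
  choose sb hsb using hsec
  let s₀ : AddSubgroup.torsionBy P ℓ →ₗ[ZMod ℓ] SM := bV.constr ℕ sb
  have hs₀ : ∀ v, πM (s₀ v) = v := by
    have h : (πM.toZModLinearMap ℓ).comp s₀ = LinearMap.id := bV.ext fun i ↦ by
      rw [LinearMap.comp_apply, LinearMap.id_apply]
      change πM (s₀ (bV i)) = bV i
      rw [show s₀ (bV i) = sb i from bV.constr_basis ℕ sb i, hsb]
    intro v
    exact LinearMap.congr_fun h v
  -- restriction of the operators of `Q` to `SM`
  have hmemQ : ∀ q : Q, ∀ x ∈ SM, (((q : ((AddMonoid.End (Fin r → AddSubgroup.torsionBy P ℓ))ˣ ×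
      (AddMonoid.End (AddSubgroup.torsionBy P ℓ))ˣ)).1 : (AddMonoid.End (Fin r →
          AddSubgroup.torsionBy P ℓ))ˣ) :
      AddMonoid.End (Fin r → AddSubgroup.torsionBy P ℓ)) x ∈ SM := fun q x hx ↦ by
    obtain ⟨σ, hσq⟩ := q.2
    rw [← hσq, hΘ₁]
    exact hSMst σ x hx
  let Tq : Q → (SM →+ SM) := fun q ↦
    (((((q : ((AddMonoid.End (Fin r → AddSubgroup.torsionBy P ℓ))ˣ × (AddMonoid.End
        (AddSubgroup.torsionBy P ℓ))ˣ)).1 : (AddMonoid.End (Fin r → AddSubgroup.torsionBy P ℓ))ˣ) :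
      AddMonoid.End (Fin r → AddSubgroup.torsionBy P ℓ)) :
        (Fin r → AddSubgroup.torsionBy P ℓ) →+ (Fin r → AddSubgroup.torsionBy P ℓ)).comp
      SM.subtype.toAddMonoidHom).codRestrict SM (fun x ↦ hmemQ q x.1 x.2)
  have hTq : ∀ (q : Q) (x : SM), (Tq q x : Fin r → AddSubgroup.torsionBy P ℓ) =
      (((q : ((AddMonoid.End (Fin r → AddSubgroup.torsionBy P ℓ))ˣ × (AddMonoid.End
          (AddSubgroup.torsionBy P ℓ))ˣ)).1 : (AddMonoid.End (Fin r → AddSubgroup.torsionBy P ℓ))ˣ)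
              :
        AddMonoid.End (Fin r → AddSubgroup.torsionBy P ℓ)) x := fun _ _ ↦ rfl
  have hπTq : ∀ (q : Q) (x : SM), πM (Tq q x) =
      (((q : ((AddMonoid.End (Fin r → AddSubgroup.torsionBy P ℓ))ˣ × (AddMonoid.End
          (AddSubgroup.torsionBy P ℓ))ˣ)).2 : (AddMonoid.End (AddSubgroup.torsionBy P ℓ))ˣ) :
        AddMonoid.End (AddSubgroup.torsionBy P ℓ)) (πM x) := fun q x ↦ by
    obtain ⟨σ, hσq⟩ := q.2
    have h1 : Tq q x = ⟨sF σ x, hSMst σ x x.2⟩ :=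
      Subtype.ext (show (Tq q x : Fin r → AddSubgroup.torsionBy P ℓ) = sF σ x by
        rw [hTq, ← hσq, hΘ₁]; exact rfl)
    rw [h1, hπMt, ← hσq, hΘ₂]
  -- the averaged section `jS = ∑_q q₁ ∘ s₀ ∘ q₂⁻¹`
  let jS : AddSubgroup.torsionBy P ℓ →+ SM := ∑ q : Q, (Tq q).comp (s₀.toAddMonoidHom.comp
      ((((q : ((AddMonoid.End (Fin r → AddSubgroup.torsionBy P ℓ))ˣ × (AddMonoid.End
          (AddSubgroup.torsionBy P ℓ))ˣ)).2⁻¹ : (AddMonoid.End (AddSubgroup.torsionBy P ℓ))ˣ) :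
        AddMonoid.End (AddSubgroup.torsionBy P ℓ)) : AddSubgroup.torsionBy P ℓ →+
            AddSubgroup.torsionBy P ℓ))
  have hjS : ∀ v, jS v = ∑ q : Q, Tq q (s₀ ((((q : ((AddMonoid.End (Fin r → AddSubgroup.torsionBy P
      ℓ))ˣ × (AddMonoid.End (AddSubgroup.torsionBy P ℓ))ˣ)).2⁻¹ :
      (AddMonoid.End (AddSubgroup.torsionBy P ℓ))ˣ) : AddMonoid.End (AddSubgroup.torsionBy P ℓ))
          v)) :=
    fun v ↦ by
      simp only [jS, AddMonoidHom.finsetSum_apply, AddMonoidHom.coe_comp, Function.comp_apply]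
      rfl
  have hπjS : ∀ v, πM (jS v) = (Fintype.card Q) • v := fun v ↦ by
    rw [hjS, map_sum]
    have : ∀ q : Q, πM (Tq q (s₀ ((((q : ((AddMonoid.End (Fin r → AddSubgroup.torsionBy P ℓ))ˣ ×
        (AddMonoid.End (AddSubgroup.torsionBy P ℓ))ˣ)).2⁻¹ :
        (AddMonoid.End (AddSubgroup.torsionBy P ℓ))ˣ) : AddMonoid.End (AddSubgroup.torsionBy P ℓ))
            v))) = v :=
      fun q ↦ by
        rw [hπTq, hs₀]
        change ((((q : ((AddMonoid.End (Fin r → AddSubgroup.torsionBy P ℓ))ˣ × (AddMonoid.End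
            (AddSubgroup.torsionBy P ℓ))ˣ)).2 : (AddMonoid.End (AddSubgroup.torsionBy P ℓ))ˣ) :
          AddMonoid.End (AddSubgroup.torsionBy P ℓ)) * (((q : ((AddMonoid.End (Fin r →
              AddSubgroup.torsionBy P ℓ))ˣ × (AddMonoid.End (AddSubgroup.torsionBy P ℓ))ˣ)).2⁻¹ :
          (AddMonoid.End (AddSubgroup.torsionBy P ℓ))ˣ) : AddMonoid.End (AddSubgroup.torsionBy P
              ℓ))) v = v
        rw [Units.mul_inv]
        rfl
    simp only [this, Finset.sum_const, Finset.card_univ]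
  -- `j = jS` followed by the inclusion
  let j : AddSubgroup.torsionBy P ℓ →+ (Fin r → AddSubgroup.torsionBy P ℓ) :=
    SM.subtype.toAddMonoidHom.comp jS
  have hj : ∀ v, j v = (jS v : Fin r → AddSubgroup.torsionBy P ℓ) := fun _ ↦ rfl
  refine ⟨j, ?_, ?_⟩
  · -- injectivity: `πM ∘ jS = |Q| •` and `ℓ ∤ |Q|`
    intro v w hvw
    have h : jS v = jS w := Subtype.ext hvw
    have h' := congrArg πM h
    rw [hπjS, hπjS, ← Nat.cast_smul_eq_nsmul (ZMod ℓ), ← Nat.cast_smul_eq_nsmul (ZMod ℓ)] at h'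
    have hunit : ((Fintype.card Q : ℕ) : ZMod ℓ) ≠ 0 := by rwa [Ne, ZMod.natCast_eq_zero_iff]
    exact smul_right_injective (AddSubgroup.torsionBy P ℓ) hunit h'
  · -- equivariance under `Γ₀`
    intro σ hσ v
    rw [← hsF, hj, hj, hjS, hjS, Submodule.coe_sum, Submodule.coe_sum, map_sum]
    let t : Q := ⟨Θ ⟨σ, hσ⟩, ⟨σ, hσ⟩, rfl⟩
    refine Fintype.sum_bijective (fun q ↦ t⁻¹ * q) (Group.mulLeft_bijective t⁻¹) _ _ fun q ↦ ?_
    rw [hTq, hTq]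
    have e1 : (((t⁻¹ * q : Q) : ((AddMonoid.End (Fin r → AddSubgroup.torsionBy P ℓ))ˣ ×
        (AddMonoid.End (AddSubgroup.torsionBy P ℓ))ˣ)).1 : (AddMonoid.End (Fin r →
            AddSubgroup.torsionBy P ℓ))ˣ) = (Θ ⟨σ, hσ⟩).1⁻¹ * (q : ((AddMonoid.End (Fin r →
                AddSubgroup.torsionBy P ℓ))ˣ × (AddMonoid.End (AddSubgroup.torsionBy P ℓ))ˣ)).1 :=
                    by
      rw [Subgroup.coe_mul, Subgroup.coe_inv, Prod.fst_mul, Prod.fst_inv]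
    have e2 : (((t⁻¹ * q : Q) : ((AddMonoid.End (Fin r → AddSubgroup.torsionBy P ℓ))ˣ ×
        (AddMonoid.End (AddSubgroup.torsionBy P ℓ))ˣ)).2⁻¹ : (AddMonoid.End (AddSubgroup.torsionBy
            P ℓ))ˣ) = (q : ((AddMonoid.End (Fin r → AddSubgroup.torsionBy P ℓ))ˣ × (AddMonoid.End
                (AddSubgroup.torsionBy P ℓ))ˣ)).2⁻¹ * (Θ ⟨σ, hσ⟩).2 := by
      rw [Subgroup.coe_mul, Subgroup.coe_inv, Prod.snd_mul, Prod.snd_inv, mul_inv_rev, inv_inv]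
    have hmulM : ∀ (f g : (AddMonoid.End (Fin r → AddSubgroup.torsionBy P ℓ))) (y : Fin r →
        AddSubgroup.torsionBy P ℓ), (f * g) y = f (g y) :=
      fun _ _ _ ↦ rfl
    have hmulV : ∀ (f g : (AddMonoid.End (AddSubgroup.torsionBy P ℓ))) (y : AddSubgroup.torsionBy P
        ℓ), (f * g) y = f (g y) := fun _ _ _ ↦ rfl
    have hcancel : ∀ y, sF σ ((((Θ ⟨σ, hσ⟩).1⁻¹ : (AddMonoid.End (Fin r → AddSubgroup.torsionBy P
        ℓ))ˣ) : (AddMonoid.End (Fin r → AddSubgroup.torsionBy P ℓ))) y) = y := fun y ↦ by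
      change ((((Θ ⟨σ, hσ⟩).1 : (AddMonoid.End (Fin r → AddSubgroup.torsionBy P ℓ))ˣ) :
          (AddMonoid.End (Fin r → AddSubgroup.torsionBy P ℓ))) * (((Θ ⟨σ, hσ⟩).1⁻¹ : (AddMonoid.End
              (Fin r → AddSubgroup.torsionBy P ℓ))ˣ) : (AddMonoid.End (Fin r →
                  AddSubgroup.torsionBy P ℓ)))) y = y
      rw [Units.mul_inv]
      rfl
    rw [e1, e2, Units.val_mul, Units.val_mul, hmulM, hmulV, hΘ₂ ⟨σ, hσ⟩, Subgroup.coe_mk, hcancel]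

end Summit.ABC.ABC.Theorems.IsotypicMinkowski

end
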